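import Literature.Computability.Complexity.HardcoreInapproximabilitySecondMomentQB
import Literature.Analysis.SpecialFunctions.ShiftedGaussLatticeSum
import HarnessLib

/-!
# The inner sum of one colour: Laplace's method on the lattice

`slyInner_sum_le`: with `h₁ = g/N - α²`, `h₂ = h/N - β²`, if every `e` with `|e/N - ε*| ≤ w` is
interior with margin `μ` and cell densities at least `m₀`, and every other `e` has rate at most
`N M_B(h₁,h₂) - Z`, then
`Σ_e B₀ t(e) ≤ e^{N M_B + Pref_B(c*)/2 + E₁} κ₃^{-1/2} (1 + τ) + (P+1) e^{N M_B - Z + 5(log N/2+2)}`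
(`E₁ = 180 N σ³/m⁴ + 19σ/(2m₀) + 11/(6μ)`, `τ = 2/(e^{2π²N/κ₃} - 1)`): the two-sided Stirling form
(`…SecondMomentColour`), the expansion of the colour rate and the completed square in `ε`
(`…SecondMomentQB`), the prefactor Lipschitz bound, and the shifted Gaussian lattice sums
(`Literature.Analysis.SpecialFunctions.ShiftedGaussLatticeSum`).

## References
* [MosselWeitzWormald2008] E. Mossel, D. Weitz, N. Wormald, PTRF 143 (2009), proof of Theorem 6.11
  (the Gaussian integral in `ε`).
* [Sly2010] A. Sly, FOCS 2010 / arXiv:1005.5584, proof of Lemma 3.5.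
-/

namespace Literature.Computability.Complexity

open Real Finset Literature.Analysis.SpecialFunctions

section Inner

/-- `x ≤ exp (log x)` for `x ≥ 0`. [folklore] -/
theorem le_exp_log_of_nonneg {x : ℝ} (hx : 0 ≤ x) : x ≤ Real.exp (Real.log x) := by
  rcases eq_or_lt_of_le hx with h | h
  · rw [← h]; exact (Real.exp_pos _).le
  · rw [Real.exp_log h]

/-- Gaussian sums over a finite set of naturals. [folklore] -/
theorem sum_nat_gauss_le {s : ℝ} (hs : 0 < s) (ν : ℝ) (F : Finset ℕ) :
    ∑ e ∈ F, rexp (-(s * ((e : ℝ) - ν) ^ 2)) ≤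
      Real.sqrt (π / s) * (1 + 2 / (rexp (π ^ 2 / s) - 1)) := by
  have h := (sum_window_gauss_bounds hs ν le_rfl (F.map Nat.castEmbedding) (fun k hk => absurd hk
    (by have := abs_nonneg ((k : ℝ) - ν); push Not; linarith))).2
  rw [Finset.sum_map] at h
  simpa using h

variable {N a b g h : ℕ} {α β w m₀ Z : ℝ} {μ : ℕ}

set_option maxHeartbeats 1600000 in
/-- **The inner sum of one colour (Laplace's method in `ε`)**: with `h₁ = g/N - α²`,
`h₂ = h/N - β²`, `σ = |h₁|+|h₂|+w`, if every `e` with `|e/N - ε*| ≤ w` is interior with margin `μ`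
and cell densities at least `m₀`, and every other `e` has rate at most `N M_B(h₁,h₂) - Z`, then
`Σ_e B₀ t(e) ≤ e^{N M_B + Pref_B(c*)/2 + E₁} κ₃^{-1/2} (1 + τ) + (P+1) e^{N M_B - Z + 5(log N/2+2)}`
with `E₁ = 180 N σ³/m⁴ + 19σ/(2m₀) + 11/(6μ)` and `τ = 2/(e^{2π²N/κ₃} - 1)`.
[cite: MosselWeitzWormald2008, proof of Theorem 6.11 (the Gaussian integral in `ε`); Sly2010, proof of Lemma 3.5] -/
theorem slyInner_sum_le (hN : 1 ≤ N) (hga : g ≤ a) (hhb : h ≤ b) (hbN : b + b - h ≤ N)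
    (habN : a + b < N) (hα : (a : ℝ) = N * α) (hβ : (b : ℝ) = N * β)
    (hα0 : 0 < α) (hβ0 : 0 < β) (hαβ : α + β < 1) (hw : 0 ≤ w)
    (hwin : |(g : ℝ) / N - α ^ 2| + |(h : ℝ) / N - β ^ 2| + w ≤
      (min (min α β) (1 - α - β)) ^ 2 / 2)
    (hμ : 1 ≤ μ)
    (hint : ∀ e : ℕ, e ≤ a - g → |(e : ℝ) / N - α * (1 - α - β)| ≤ w →
      (μ ≤ g ∧ g + μ ≤ N - (b + b - h)) ∧ (μ ≤ e ∧ e + μ ≤ N - (b + b - h) - g) ∧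
      (μ ≤ a - g - e ∧ a - g - e + μ ≤ b - h) ∧ (μ ≤ a - g ∧ a - g + μ ≤ N - b - g - e) ∧
      (μ ≤ a ∧ a - g + μ ≤ N - a ∧ a + μ ≤ N - b))
    (hm₀ : 0 < m₀) (hcell0 : ∀ u ∈ slyCells α β (α ^ 2) (β ^ 2) (α * (1 - α - β)), m₀ ≤ u)
    (hcell : ∀ e : ℕ, e ≤ a - g → |(e : ℝ) / N - α * (1 - α - β)| ≤ w →
      ∀ u ∈ slyCells α β ((g : ℝ) / N) ((h : ℝ) / N) ((e : ℝ) / N), m₀ ≤ u)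
    (hfar : ∀ e : ℕ, e ≤ a - g → w < |(e : ℝ) / N - α * (1 - α - β)| →
      slyT N a b g h e ≠ 0 →
      N * slyGrate α β ((g : ℝ) / N) ((h : ℝ) / N) ((e : ℝ) / N) ≤
        N * slyMB α β ((g : ℝ) / N - α ^ 2) ((h : ℝ) / N - β ^ 2) - Z) :
    ∑ e ∈ range (a - g + 1), slyB0 N a b g h * slyT N a b g h e ≤
      Real.exp (N * slyMB α β ((g : ℝ) / N - α ^ 2) ((h : ℝ) / N - β ^ 2) +
          slyPrefB α β (α ^ 2) (β ^ 2) (α * (1 - α - β)) / 2 +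
          (180 * N * (|(g : ℝ) / N - α ^ 2| + |(h : ℝ) / N - β ^ 2| + w) ^ 3 /
              (min (min α β) (1 - α - β)) ^ 4 +
            19 * (|(g : ℝ) / N - α ^ 2| + |(h : ℝ) / N - β ^ 2| + w) / (2 * m₀) +
            11 / (6 * (μ : ℝ)))) *
        (1 / Real.sqrt (slyK3 α β)) * (1 + 2 / (rexp (π ^ 2 / (slyK3 α β / (2 * N))) - 1)) +
      ((a - g + 1 : ℕ) : ℝ) *
        Real.exp (N * slyMB α β ((g : ℝ) / N - α ^ 2) ((h : ℝ) / N - β ^ 2) - Z +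
          5 * (Real.log N / 2 + 2)) := by
  -- notation
  set γ : ℝ := (g : ℝ) / N with hγ
  set δ : ℝ := (h : ℝ) / N with hδ
  set h₁ : ℝ := γ - α ^ 2 with hh₁
  set h₂ : ℝ := δ - β ^ 2 with hh₂
  set εs : ℝ := α * (1 - α - β) with hεs
  set σ : ℝ := |h₁| + |h₂| + w with hσ
  set m : ℝ := min (min α β) (1 - α - β) with hm
  set MB : ℝ := slyMB α β h₁ h₂ with hMB
  set κ : ℝ := slyK3 α β with hκ
  have hNR : (0 : ℝ) < N := by exact_mod_cast (lt_of_lt_of_le Nat.zero_lt_one hN)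
  have hκ0 : 0 < κ := slyK3_pos hα0 hβ0 hαβ
  have hmpos : 0 < m := lt_min (lt_min hα0 hβ0) (by linarith)
  have hσ0 : 0 ≤ σ := by positivity
  -- split the range
  set Near := (range (a - g + 1)).filter (fun e : ℕ => |(e : ℝ) / N - εs| ≤ w) with hNear
  set Far := (range (a - g + 1)).filter (fun e : ℕ => ¬ |(e : ℝ) / N - εs| ≤ w) with hFar
  have hsplit : ∑ e ∈ range (a - g + 1), slyB0 N a b g h * slyT N a b g h e =
      ∑ e ∈ Near, slyB0 N a b g h * slyT N a b g h e +
        ∑ e ∈ Far, slyB0 N a b g h * slyT N a b g h e := by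
    rw [hNear, hFar, Finset.sum_filter_add_sum_filter_not]
  rw [hsplit]
  -- the constant of the near terms
  set E₁ : ℝ := 180 * N * σ ^ 3 / m ^ 4 + 19 * σ / (2 * m₀) + 11 / (6 * (μ : ℝ)) with hE₁
  set C₀ : ℝ := N * MB + slyPrefB α β (α ^ 2) (β ^ 2) εs / 2 + E₁ - Real.log (2 * π * N) / 2
    with hC₀
  set s : ℝ := κ / (2 * N) with hs
  have hs0 : 0 < s := by positivity
  set ν : ℝ := N * (εs + slyHhat α β h₁ h₂) with hν
  -- NEAR: termwise Gaussian domination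
  have hnear : ∀ e ∈ Near, slyB0 N a b g h * slyT N a b g h e ≤
      Real.exp C₀ * rexp (-(s * ((e : ℝ) - ν) ^ 2)) := by
    intro e he
    rw [hNear, mem_filter, mem_range, Nat.lt_succ_iff] at he
    obtain ⟨heP, hew⟩ := he
    obtain ⟨⟨k1, k1'⟩, ⟨k2, k2'⟩, ⟨k3, k3'⟩, ⟨k4, k4'⟩, ⟨k5, k9', k10'⟩⟩ := hint e heP hew
    have hI := log_slyB0_mul_slyT_interior hga hhb hbN habN heP hμ k1 k1' k2 k2' k3 k3' k4 k4'
      k5 k9' k10'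
    rw [abs_le] at hI
    -- densities `a/N = α`, `b/N = β`
    have eα : (a : ℝ) / N = α := by rw [hα]; field_simp
    have eβ : (b : ℝ) / N = β := by rw [hβ]; field_simp
    rw [eα, eβ, ← hγ, ← hδ] at hI
    -- Taylor at the product point
    set h₃ : ℝ := (e : ℝ) / N - εs with hh₃
    have hs3 : |h₁| + |h₂| + |h₃| ≤ σ := by rw [hσ]; linarith
    have hT := abs_slyGrate_sub_slyQB_le hα0 hβ0 hαβ (h₁ := h₁) (h₂ := h₂) (h₃ := h₃) hm rfl
      (le_trans hs3 hwin)
    have eG : slyGrate α β (α ^ 2 + h₁) (β ^ 2 + h₂) (α * (1 - α - β) + h₃) =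
        slyGrate α β γ δ ((e : ℝ) / N) := by
      rw [hh₁, hh₂, hh₃, hεs]; ring_nf
    rw [eG, abs_le] at hT
    have hcube : (|h₁| + |h₂| + |h₃|) ^ 3 / m ^ 4 ≤ σ ^ 3 / m ^ 4 := by
      apply div_le_div_of_nonneg_right _ (by positivity)
      exact pow_le_pow_left₀ (by positivity) hs3 3
    -- complete the square
    have hCS := slyQB_complete_square hα0 hβ0 hαβ h₁ h₂ h₃
    rw [← hMB, ← hκ] at hCS
    have hCSN : (N : ℝ) * slyQB α β h₁ h₂ h₃ =
        N * MB - N * (κ / 2 * (h₃ - slyHhat α β h₁ h₂) ^ 2) := by rw [hCS]; ring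
    -- prefactor Lipschitz
    have hP := abs_slyPrefB_sub_le (α := α) (β := β) hm₀ (hcell e heP hew) hcell0
    rw [abs_le] at hP
    have hdist : (|γ - α ^ 2| + |δ - β ^ 2| + |(e : ℝ) / N - εs|) / m₀ ≤ σ / m₀ := by
      apply div_le_div_of_nonneg_right _ hm₀.le
      rw [hσ, hh₁, hh₂]; linarith
    -- assemble the exponent bound
    have hpos : 0 ≤ slyB0 N a b g h * slyT N a b g h e := by
      unfold slyB0 slyT; positivity
    refine le_trans (le_exp_log_of_nonneg hpos) ?_
    rw [← Real.exp_add, Real.exp_le_exp]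
    have hsq : s * ((e : ℝ) - ν) ^ 2 = N * (κ / 2 * (h₃ - slyHhat α β h₁ h₂) ^ 2) := by
      rw [hs, hν, hh₃]; field_simp; ring
    rw [hsq]
    have hG : slyGrate α β γ δ ((e : ℝ) / N) ≤ slyQB α β h₁ h₂ h₃ + 180 * (σ ^ 3 / m ^ 4) := by
      linarith [hT.2, hcube]
    have hNG := mul_le_mul_of_nonneg_left hG hNR.le
    have hPe : slyPrefB α β γ δ ((e : ℝ) / N) ≤ slyPrefB α β (α ^ 2) (β ^ 2) εs + 19 * (σ / m₀) := by
      linarith [hP.2, hdist]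
    calc Real.log (slyB0 N a b g h * slyT N a b g h e)
        ≤ N * slyGrate α β γ δ ((e : ℝ) / N) +
            (slyPrefB α β γ δ ((e : ℝ) / N) - Real.log (2 * π * N)) / 2 + 11 / (6 * (μ : ℝ)) := by
          linarith [hI.2]
      _ ≤ N * (slyQB α β h₁ h₂ h₃ + 180 * (σ ^ 3 / m ^ 4)) +
            ((slyPrefB α β (α ^ 2) (β ^ 2) εs + 19 * (σ / m₀)) - Real.log (2 * π * N)) / 2 +
            11 / (6 * (μ : ℝ)) := by linarith [hNG, hPe]
      _ = C₀ + -(N * (κ / 2 * (h₃ - slyHhat α β h₁ h₂) ^ 2)) := by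
          rw [hCS, hC₀, hE₁]; ring
  -- NEAR: sum
  have hNearSum : ∑ e ∈ Near, slyB0 N a b g h * slyT N a b g h e ≤
      Real.exp C₀ * (Real.sqrt (π / s) * (1 + 2 / (rexp (π ^ 2 / s) - 1))) := by
    refine le_trans (sum_le_sum hnear) ?_
    rw [← mul_sum]
    exact mul_le_mul_of_nonneg_left (sum_nat_gauss_le hs0 ν Near) (Real.exp_pos _).le
  -- FAR: termwise
  have hfarT : ∀ e ∈ Far, slyB0 N a b g h * slyT N a b g h e ≤
      Real.exp (N * MB - Z + 5 * (Real.log N / 2 + 2)) := by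
    intro e he
    rw [hFar, mem_filter, mem_range, Nat.lt_succ_iff, not_le] at he
    obtain ⟨heP, hew⟩ := he
    by_cases ht : slyT N a b g h e = 0
    · rw [ht, mul_zero]; exact (Real.exp_pos _).le
    have hup := slyB0_mul_slyT_le hN hga hhb hbN habN heP
    have eα : (a : ℝ) / N = α := by rw [hα]; field_simp
    have eβ : (b : ℝ) / N = β := by rw [hβ]; field_simp
    rw [eα, eβ] at hup
    refine le_trans hup ?_
    rw [Real.exp_le_exp]
    have := hfar e heP hew ht
    linarith
  have hFarSum : ∑ e ∈ Far, slyB0 N a b g h * slyT N a b g h e ≤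
      ((a - g + 1 : ℕ) : ℝ) * Real.exp (N * MB - Z + 5 * (Real.log N / 2 + 2)) := by
    refine le_trans (sum_le_sum hfarT) ?_
    rw [sum_const, nsmul_eq_mul]
    apply mul_le_mul_of_nonneg_right _ (Real.exp_pos _).le
    have : Far.card ≤ a - g + 1 := by
      rw [hFar]; exact le_trans (card_filter_le _ _) (by simp)
    exact_mod_cast this
  -- constants: `e^{C₀} √(π/s) = e^{N MB + Pref/2 + E₁} / √κ`
  have hconst : Real.exp C₀ * Real.sqrt (π / s) =
      Real.exp (N * MB + slyPrefB α β (α ^ 2) (β ^ 2) εs / 2 + E₁) * (1 / Real.sqrt κ) := by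
    have e1 : Real.sqrt (π / s) = Real.sqrt (2 * π * N) * (1 / Real.sqrt κ) := by
      rw [hs, show π / (κ / (2 * N)) = (2 * π * N) / κ by field_simp, Real.sqrt_div (by positivity)]
      ring
    have e2 : Real.exp C₀ = Real.exp (N * MB + slyPrefB α β (α ^ 2) (β ^ 2) εs / 2 + E₁) /
        Real.sqrt (2 * π * N) := by
      rw [hC₀, eq_div_iff (Real.sqrt_pos.mpr (by positivity)).ne', ← Real.exp_log
        (Real.sqrt_pos.mpr (by positivity : (0:ℝ) < 2 * π * N)), ← Real.exp_add, Real.log_sqrt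
        (by positivity)]
      ring_nf
    rw [e1, e2]
    field_simp
  calc ∑ e ∈ Near, slyB0 N a b g h * slyT N a b g h e + ∑ e ∈ Far, slyB0 N a b g h * slyT N a b g h e
      ≤ Real.exp C₀ * (Real.sqrt (π / s) * (1 + 2 / (rexp (π ^ 2 / s) - 1))) +
          ((a - g + 1 : ℕ) : ℝ) * Real.exp (N * MB - Z + 5 * (Real.log N / 2 + 2)) :=
        add_le_add hNearSum hFarSum
    _ = _ := by rw [← mul_assoc, hconst]

end Inner

end Literature.Computability.Complexity
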